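import Literature.NumberTheory.FaltingsSerre.Paramodular353Holds
import HarnessLib

/-!
# `N = 353` (isogeny class 353.a): `A₃₅₃` is paramodular of level `353` away from `353` — summit-side headline
# (cell `pub-paramod`; certificate `certs/353/certificate.canonical.json`, sha256 `f9c58454c0fee8091a6b9e1fefbb18ffc9cb091db6d4d5113f028da54859e767`)

HONEST FRAMING: an INSTANCE theorem by a PUBLISHED method (the Faltings–Serre method as
Brumer–Pacetti–Poor–Tornaría–Voight–Yuen apply it); the cell's value is certified coverage of LMFDB
genus-2 curves, NOT a new modularity theorem.  This pair is a RE-CERTIFICATION of the PRINTED theorem [BPPTVY, Thm 7.2.1 p. 1189] (own check-prime set `P(353)`, a subset of the printed fifteen primes; own residual sieve; every Hecke eigenvalue recomputed twice; referee ruling S44, Audits 75–76).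

[BPPTVY] = A. Brumer, A. Pacetti, C. Poor, G. Tornaría, J. Voight, D. S. Yuen, *On the paramodularity of
typical abelian surfaces*, Algebra & Number Theory **13**:5 (2019) 1145–1195 [cite: BrumerEtAl2019]
(criterion Thm 2.1.5 p. 1150 / Alg 2.4.1 p. 1155; form-side Galois representation Thm 4.3.4 p. 1169;
shape of the conclusion Thm 7.1.3 p. 1187).  [PY15] = C. Poor, D. S. Yuen, *Paramodular cusp forms*,
Math. Comp. **84** (2015) 1401–1438 [cite: PoorYuen2015].  [PSY20] = C. Poor, J. Shurman, D. S. Yuen,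
*Nonlift weight two paramodular eigenform constructions*, J. Korean Math. Soc. **57** (2020) 507–522
[cite: PoorShurmanYuen2020].  [BK14] = A. Brumer, K. Kramer, *Paramodular abelian varieties of odd
conductor*, Trans. Amer. Math. Soc. **366** (2014) 2463–2516 [cite: BrumerKramer2014].

THE PAIR.  `A₃₅₃ = Jac(C)`, `C₃₅₃ : y² + (x³+x+1)y = x²`, isogeny class 353.a (LMFDB `353.a.353.1`); `f₃₅₃` = the weight-2 paramodular NONLIFT
Hecke eigenform of level `353` with rational eigenvalues [BPPTVY, §6; PY15, Table 5 p. 1433; PSY20, Thm 1.1 p. 508, Thm 1.2 p. 509].  Residual image of `ρ̄_{A,2}`: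
`S₃ ≀ C₂`; check primes `P = {3, 5, 7, 11, 13, 19, 37, 41, 97, 137}`; trace table `a_p(A₃₅₃) = a_p(f₃₅₃)` on `P`: `−2, 1, 0, 2, −1, −6, 5, 6, −11, −9` — every
load-bearing datum of the certificate by TWO independent implementations that agree (cell rule).

WHAT THIS FILE IS (placement).  The SUMMIT-SIDE HOME of the headline — the brief's TARGET path
`lean/Summits/Langlands/Paramodular/<N>.lean` (human LEAN PLACEMENT RULE of 2026-08-19: new work under
`Summits/<Summit>/<cell topic>/`; cell topic `Langlands/Paramodular` registered 2026-08-20).  It is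
deprecate-and-add STEP 1 ("add"): the statement below is LITERALLY the criterion-free instance statement
of `Literature.NumberTheory.FaltingsSerre.Paramodular353.paramodular_353_holds`
(`Literature/NumberTheory/FaltingsSerre/Paramodular353Holds.lean`, p189506) and is PROVED BY that theorem; nothing under `Literature/`
is edited or moved by this file (the rule forbids self-moves; the import-safe migration of the bodies is
the gate's, cell record `pub-paramod-lit/LEAN-PLACEMENT-AUDIT-g16.md` §4 — the cell's import cone is
closed, so re-pointing is internal).  The instance with the criterion as a binder is
`Literature.NumberTheory.FaltingsSerre.Paramodular353.paramodular_353` (Paramodular353.lean, p188920);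
the criterion [BPPTVY, Thm 2.1.5 / Alg 2.4.1] is a KERNEL THEOREM
(`Literature.NumberTheory.FaltingsSerre.traceEq_of_faltingsSerre_symplectic_holds`, `CriterionProofs.lean`, p181742), which is why it
is no longer a hypothesis here.

WHAT IS HYPOTHESIS AND WHAT IS PROVED.  Binders (exactly those of the Literature theorem): the
CERTIFICATE `hC : Paramodular353.Certificate353 J ν ρA ρf` — the `Prop` that the computed data
discharge the criterion's inputs for (`ρA`, `ρf`); it is discharged OUTSIDE the kernel by the frozen,
twice-computed certificate file `certs/353/certificate.canonical.json` (canonical sha256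
`f9c58454c0fee8091a6b9e1fefbb18ffc9cb091db6d4d5113f028da54859e767`; ABSOLUTE RULE of the cell: a certificate is a
binder, never a Literature fact); the `A`-side frame and good Euler factors `hframe`, `hA` (surface shape
`1 − aT + bT² − paT³ + p²T⁴`); the form-side `2`-adic representation `hρf` = [BPPTVY, Thm 4.3.4 p. 1169]
(ARTHUR-DEPENDENT via Mok 2014 — an input, flagged by the referee, protocol A7); the form data `hcusp`,
`hne`, `hfe`; and the coefficientwise check at `p = 2 = ℓ` (certificate data, cell DIVERGENCE.md D-4).
CONCLUSION `IsParamodularAwayFrom A 353 f`: `f` is a nonzero weight-2 paramodular cusp form of level `353`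
and `L_p(A,T) = Q_p(f,T)` for EVERY prime `p ≠ 353` (the Euler factor AT `353` is not certified, D-4;
nothing here says "modular (GL₄)", referee S3).  `#print axioms` of both theorems below ⊆
{propext, Classical.choice, Quot.sound} (inherited from the Literature proof; gate axiom audit).
-/

noncomputable section

namespace Summit.Langlands.Paramodular

open Polynomial IsDedekindDomain
open Literature.NumberTheory.FaltingsSerre Literature.NumberTheory.GaloisRepresentations
  Literature.NumberTheory.Automorphic.Paramodular Literature.NumberTheory.Automorphic
  Literature.AlgebraicGeometry.Motives
open scoped NumberField

/-- **`A₃₅₃` (353.a) is paramodular of level `353` away from `353`, with partner `f₃₅₃`** —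
summit-side headline; statement = the criterion-free instance statement, proof =
`Literature.NumberTheory.FaltingsSerre.Paramodular353.paramodular_353_holds`.  From the frozen certificate `hC`
(sha256 `f9c58454c0fe…`), the `A`-side frame/Euler data, the cited
`ρ_{f,2}` [BPPTVY, Thm 4.3.4] and the form data: `IsParamodularAwayFrom A 353 f`.  Re-certification of a PRINTED theorem.
[cite: BrumerEtAl2019, Thm 7.2.1 p. 1189; Thm 2.1.5 p. 1150; Alg 2.4.1 p. 1155; Thm 4.3.4 p. 1169] -/
theorem paramodular_353
    {A : AbelianVariety ℚ} {f : Matrix (Fin 2) (Fin 2) ℂ → ℂ}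
    {ρA ρf : FramedGaloisRep ℚ ℤ_[2] 4} {J : Matrix (Fin 4) (Fin 4) ℤ_[2]}
    {ν : Field.absoluteGaloisGroup ℚ → ℤ_[2]}
    {b : Module.Basis (Fin 4) ℚ_[2] (A.rationalTateModule 2)}
    (hC : Paramodular353.Certificate353 J ν ρA ρf)
    (hframe : A.IsFrameOfTateRep 2 b (rationalize ρA))
    (aA bA af bf : ℕ → ℤ)
    (hA : ∀ p : ℕ, p.Prime → ¬ p ∣ 353 →
      A.HasGoodEulerFactorAt p ((lPolynomialOfSurface p (aA p) (bA p)).map (Int.castRingHom ℚ)))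
    (hρf : ∀ p : ℕ, p.Prime → ¬ p ∣ 353 → p ≠ 2 →
      ∀ v : HeightOneSpectrum (𝓞 ℚ), ((p : ℕ) : 𝓞 ℚ) ∈ v.asIdeal →
        ρf.HasFrobCharpolyAt v
          ((lPolynomialOfSurface p (af p) (bf p)).reverse.map (Int.castRingHom ℤ_[2])))
    (hcusp : IsParamodularCuspForm 353 2 f) (hne : ∃ Z ∈ siegelUpperHalfSpace 2, f Z ≠ 0)
    (hfe : ∀ p : ℕ, p.Prime → ¬ p ∣ 353 →
      HasSpinorEulerFactorAt 2 p f ((lPolynomialOfSurface p (af p) (bf p)).map (Int.castRingHom ℂ)))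
    (h2 : aA 2 = af 2 ∧ bA 2 = bf 2) :
    IsParamodularAwayFrom A 353 f :=
  Literature.NumberTheory.FaltingsSerre.Paramodular353.paramodular_353_holds hC hframe aA bA af bf hA hρf hcusp
    hne hfe h2

/-- The conclusion unfolded at one prime `p ≠ 353`: ONE polynomial `Q ∈ ℚ[T]` is both the spinor Euler
factor `Q_p(f₃₅₃,T)` and the good Euler factor `L_p(A₃₅₃,T)`. [cite: BrumerEtAl2019, Thm 7.2.1 p. 1189] -/
theorem eulerFactors_agree_353
    {A : AbelianVariety ℚ} {f : Matrix (Fin 2) (Fin 2) ℂ → ℂ}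
    {ρA ρf : FramedGaloisRep ℚ ℤ_[2] 4} {J : Matrix (Fin 4) (Fin 4) ℤ_[2]}
    {ν : Field.absoluteGaloisGroup ℚ → ℤ_[2]}
    {b : Module.Basis (Fin 4) ℚ_[2] (A.rationalTateModule 2)}
    (hC : Paramodular353.Certificate353 J ν ρA ρf)
    (hframe : A.IsFrameOfTateRep 2 b (rationalize ρA))
    (aA bA af bf : ℕ → ℤ)
    (hA : ∀ p : ℕ, p.Prime → ¬ p ∣ 353 →
      A.HasGoodEulerFactorAt p ((lPolynomialOfSurface p (aA p) (bA p)).map (Int.castRingHom ℚ)))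
    (hρf : ∀ p : ℕ, p.Prime → ¬ p ∣ 353 → p ≠ 2 →
      ∀ v : HeightOneSpectrum (𝓞 ℚ), ((p : ℕ) : 𝓞 ℚ) ∈ v.asIdeal →
        ρf.HasFrobCharpolyAt v
          ((lPolynomialOfSurface p (af p) (bf p)).reverse.map (Int.castRingHom ℤ_[2])))
    (hcusp : IsParamodularCuspForm 353 2 f) (hne : ∃ Z ∈ siegelUpperHalfSpace 2, f Z ≠ 0)
    (hfe : ∀ p : ℕ, p.Prime → ¬ p ∣ 353 →
      HasSpinorEulerFactorAt 2 p f ((lPolynomialOfSurface p (af p) (bf p)).map (Int.castRingHom ℂ)))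
    (h2 : aA 2 = af 2 ∧ bA 2 = bf 2) {p : ℕ} (hp : p.Prime) (hpN : p ≠ 353) :
    ∃ Q : Polynomial ℚ, HasSpinorEulerFactorAt 2 p f (Q.map (algebraMap ℚ ℂ)) ∧
      A.HasGoodEulerFactorAt p Q :=
  Literature.NumberTheory.FaltingsSerre.Paramodular353.eulerFactors_agree_353
    (paramodular_353 hC hframe aA bA af bf hA hρf hcusp hne hfe h2) hp hpN

end Summit.Langlands.Paramodular

end
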